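import Literature.NumberTheory.Rogawski1990.ArchTorusOrbitalCompactWallValueLimitsGlobal   -- ★ LH3-p04 (g2) brick C: bare orbital function `C¹` across a compact wall (global); brings brick A, (C-bdry-glob), (δ), J1
import Literature.NumberTheory.Rogawski1990.ArchEndoscopicTransferContinuousGWall        -- ★ LH3-p04 (g2) p849710 (M2-01-curve): brings ★ p849548 (Δ-def-explicit) and the curve bookkeeping
import HarnessLib

/-!
# (M2∕M3-def) At a DEFINITE place the `Δ″`-side of `Θ ∈ C_c^∞(G′_∞)` is `C¹` across the `H`-wall `z₀ = z₂` along the normal curve — no jump, no kink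
# (Rogawski 1990 §4.9 p. 55, §8.2 pp. 119–124, §14.2 p. 232; Shelstad 1979 §4; Varadarajan 1989 §2.4)

Topic `NumberTheory/Rogawski1990`; namespace `Literature.NumberTheory.Rogawski1990`.  THEOREMS ONLY (no `def`, no instance, no notation, no axiom, no named fact, no `sorry`).
Cell `pub/hodgecm-mathlib`, line LH3 (closer stub `stub_N9`, crux H413 = `stmt-HodgeConjecture-24833`), organs **(M2-def)∕(M3-def)** of LH3-plan (g2)'s D2′-SPEC §3 («at `w ∈ W_def`
all three walls compact, one class, κ constant: every term smooth across the walls given the μ-guard … (M3-def): at a definite place … `R_H·φ^H` is smooth across the H-wall ⇒ jump 0»).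
Companion of ★ p849710 (M2-01-curve) (any signature, the `G`-walls `z₁ = z₀`, `z₁ = z₂`): here the `H`-WALL `z₀ = z₂` at a place `w` where the form is DEFINITE
(`0 < re σ_w(α_i)·re σ_w(α_j)` for all `i, j`).

SETTING (★ p849710 ∕ ★ (C-bdry-glob)).  Base `z` regular off `w`, `z_{w,0} = z_{w,2} ≠ z_{w,1}`, the curve `z^ψ = update z w (i ↦ z_{w,i} e^{i(1,0,−1)_i ψ})`; the `H`-point IS
`γ_H(z^ψ)` (2-block eigenvalues `ζ₀e^{±iψ}` coalescing at `ψ = 0`: the `H`-wall, `H`-singular), partners `t(z^ψ ∘ ρ)`, `ρ : W → S₃`.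

THE MATHEMATICS.  `Δ″(γ_H(z^ψ), t(z^ψ∘ρ)) = K_ρ·(τ·D_{G∕H})(γ_H(z^ψ))` (★ p849548) and on this curve `(τ·D)(ψ) = C·(−((ζ₀²)^{k}(ζ₁ − ζ₀e^{iψ})(ζ₁ − ζ₀e^{−iψ}))∕ζ₁)` is ENTIRE and does
NOT vanish at `ψ = 0` (`z₀z₂ = ζ₀²` is constant along the curve; the `H`-root is not a `G∕H`-root); every partner's `w`-wall `(ρ_w⁻¹0, ρ_w⁻¹2)` is COMPACT at a definite place, so the
bare orbital function `O_ρ` is `C¹` through `ψ = 0` (★ brick C).  Hence `F = S·Σ_ρ K_ρ O_ρ` with `S` smooth: `F → A`, `F′ → B` two-sidedly — the `H`-side stable jump at a definite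
place VANISHES, consistent with «no partner for a split 2-block at a definite place» ((VANISH-def)).

WHAT IS PROVED.  `differentiableAt_integral_comp_conj_archDiagTorus_update_splitCurve_comp` (bare `O_ρ` differentiable at regular parameters),
**`exists_tendsto_sum_archExplicitDelta_mul_integral_splitCurve_hWall_of_definite`** (+ `_aux` with the curve as an equality binder).
HONEST LABEL: HC_CM is proved only modulo the 7 printed citations (2 remaining: hLiu418 = stmt-HodgeConjecture-24832, h413 = stmt-HodgeConjecture-24833) until rung 0 closes; organ of
`stub_N9`'s L2, pays nothing by itself.

## References
* [Rogawski1990] J. D. Rogawski, *Automorphic Representations of Unitary Groups in Three Variables*, Ann. of Math. Stud. 123 (1990), §4.9 p. 55, §8.2 pp. 119–124, §14.2 p. 232.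
* [Shelstad1979] D. Shelstad, *Characters and inner forms of a quasi-split group over ℝ*, Compositio Math. 39 (1979), §4.
* [Varadarajan1989] V. S. Varadarajan, *An Introduction to Harmonic Analysis on Semisimple Lie Groups* (1989), §2.4 Thm. 8, §6.4.
-/

set_option autoImplicit false

noncomputable section

open MeasureTheory Measure Filter Topology NumberField NumberField.InfinitePlace NumberField.mixedEmbedding Equiv Function Set
open Literature.MeasureTheory.Group Literature.NumberTheory.Automorphic Literature.NumberTheory.Automorphic.UnitaryGroup Literature.NumberTheory.GaloisRepresentations
open Literature.LinearAlgebra.Matrix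
open scoped Matrix MatrixGroups Matrix.Norms.Operator ContDiff ComplexConjugate

namespace Literature.NumberTheory.Rogawski1990

section HWall

variable (L : Type) [Field L] [NumberField L] [IsCMField L] (α : Fin 3 → L) (w : {w : InfinitePlace L // IsComplex w})
  [MeasurableSpace (GL (Fin 3) ℂ)] [BorelSpace (GL (Fin 3) ℂ)]
  [MeasurableSpace (arch (↥(maximalRealSubfield L)) L (IsCMField.complexConj L) 3 (Matrix.diagonal α))] [BorelSpace (arch (↥(maximalRealSubfield L)) L (IsCMField.complexConj L) 3 (Matrix.diagonal α))]

open scoped Classical in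
/-- **`O_ρ` IS DIFFERENTIABLE AT EVERY REGULAR PARAMETER** (bare orbital function): for `ψ` with `z^ψ_w` regular (and `z` regular off `w`),
`ψ ↦ ∫_{G′_∞} Θ(↑↑(g·t(z^ψ∘ρ)·g⁻¹)) dν_∞` is differentiable at `ψ` (on the open regular set it is the per-place function of the partial orbital lambda, ★ (δ) + ★ J1).
[cite: Rogawski1990, §8.2 p. 122] [cite: Varadarajan1989, §6.4 Thm 18] -/
theorem differentiableAt_integral_comp_conj_archDiagTorus_update_splitCurve_comp
    (νw : ∀ v : {w : InfinitePlace L // IsComplex w}, Measure (archLocal L 3 (Matrix.diagonal α) v)) [∀ v, (νw v).IsHaarMeasure]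
    (hα : ∀ i, α i ≠ 0) (hherm : ∀ i, (IsCMField.complexConj L (α i) : L) = α i)
    (Θ : Matrix (Fin 3) (Fin 3) (mixedSpace L) → ℂ) (hΘ : ContDiff ℝ (⊤ : ℕ∞) Θ)
    (hΘc : HasCompactSupport fun g : arch (↥(maximalRealSubfield L)) L (IsCMField.complexConj L) 3 (Matrix.diagonal α) => Θ ((g : GL (Fin 3) (mixedSpace L)) : Matrix (Fin 3) (Fin 3) (mixedSpace L)))
    (z : {w : InfinitePlace L // IsComplex w} → Fin 3 → Circle) (hz : ∀ v, v ≠ w → Function.Injective (z v))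
    (ρ : {w : InfinitePlace L // IsComplex w} → Perm (Fin 3)) {ψ : ℝ} (hψ : Function.Injective fun i => z w i * Circle.exp (![(1 : ℝ), 0, -1] i * ψ)) :
    DifferentiableAt ℝ (fun ψ : ℝ =>
        ∫ g, Θ (((g * archDiagTorus L 3 α (fun v => Function.update z w (fun i => z w i * Circle.exp (![(1 : ℝ), 0, -1] i * ψ)) v ∘ ⇑(ρ v)) * g⁻¹ :
          arch (↥(maximalRealSubfield L)) L (IsCMField.complexConj L) 3 (Matrix.diagonal α)) : GL (Fin 3) (mixedSpace L)) : Matrix (Fin 3) (Fin 3) (mixedSpace L))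
          ∂((Measure.pi νw).map (archPiEquivCM 3 L (Matrix.diagonal α)).symm)) ψ := by
  have hreal : ∀ i, (w.1.embedding (α i)).im = 0 := fun i => im_embedding_eq_zero_of_complexConj_eq L w (hherm i)
  haveI : ∀ v : {w : InfinitePlace L // IsComplex w}, LocallyCompactSpace (archLocal L 3 (Matrix.diagonal α) v) := fun v => locallyCompactSpace_archLocal L 3 (Matrix.diagonal α) v
  haveI : ∀ v : {w : InfinitePlace L // IsComplex w}, SecondCountableTopology (archLocal L 3 (Matrix.diagonal α) v) := fun v => secondCountableTopology_archLocal L 3 (Matrix.diagonal α) v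
  obtain ⟨Θ', hΘ', hΘ'c, hΘ'eq⟩ := exists_contDiff_partialOrbital_eq L 3 α νw hα w Θ hΘ hΘc (z := fun v => z v ∘ ⇑(ρ v))
    (fun v hv => (hz v hv).comp (ρ v).injective)
  have hΘ'1 : ContDiff ℝ 1 Θ' := hΘ'.of_le (by exact_mod_cast le_top)
  set T : Set ℝ := {ψ | Function.Injective fun i => z w i * Circle.exp (![(1 : ℝ), 0, -1] i * ψ)} with hT
  have hTopen : IsOpen T := isOpen_setOf_injective.preimage (continuous_torusCurve (z w) ![(1 : ℝ), 0, -1])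
  have heq : ∀ ψ ∈ T,
      ∫ g, Θ (((g * archDiagTorus L 3 α (fun v => Function.update z w (fun i => z w i * Circle.exp (![(1 : ℝ), 0, -1] i * ψ)) v ∘ ⇑(ρ v)) * g⁻¹ :
        arch (↥(maximalRealSubfield L)) L (IsCMField.complexConj L) 3 (Matrix.diagonal α)) : GL (Fin 3) (mixedSpace L)) : Matrix (Fin 3) (Fin 3) (mixedSpace L))
        ∂((Measure.pi νw).map (archPiEquivCM 3 L (Matrix.diagonal α)).symm) =
      ∫ g : archLocal L 3 (Matrix.diagonal α) w,
        Θ' ((((g * ⟨circleDiagonal 3 ((fun i => z w i * Circle.exp (![(1 : ℝ), 0, -1] i * ψ)) ∘ ⇑(ρ w)), circleDiagonal_mem_archLocal_diagonal L 3 α w _⟩ * g⁻¹ :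
          archLocal L 3 (Matrix.diagonal α) w) : GL (Fin 3) ℂ) : Matrix (Fin 3) (Fin 3) ℂ)) ∂(νw w) := by
    intro ψ hψ
    have hreg : ∀ v, Function.Injective (Function.update z w (fun i => z w i * Circle.exp (![(1 : ℝ), 0, -1] i * ψ)) v ∘ ⇑(ρ v)) := by
      intro v
      by_cases hv : v = w
      · subst hv; rw [Function.update_self]; exact (show Function.Injective _ from hψ).comp (ρ v).injective
      · rw [Function.update_of_ne hv]; exact (hz v hv).comp (ρ v).injective
    rw [integral_comp_conj_archDiagTorus_update_comp_eq_integral_partial L α w νw hα Θ hΘ.continuous hΘc z _ ρ hreg]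
    refine integral_congr_ae (Eventually.of_forall fun x => ?_)
    exact (hΘ'eq _).symm
  have hloc : DifferentiableAt ℝ (fun ψ : ℝ => ∫ g : archLocal L 3 (Matrix.diagonal α) w,
      Θ' ((((g * ⟨circleDiagonal 3 ((fun i => z w i * Circle.exp (![(1 : ℝ), 0, -1] i * ψ)) ∘ ⇑(ρ w)), circleDiagonal_mem_archLocal_diagonal L 3 α w _⟩ * g⁻¹ :
        archLocal L 3 (Matrix.diagonal α) w) : GL (Fin 3) ℂ) : Matrix (Fin 3) (Fin 3) ℂ)) ∂(νw w)) ψ :=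
    differentiableAt_integral_comp_conj_splitCurve_comp_perm L α w hα hreal (νw w) Θ' hΘ'1 hΘ'c (z w) (ρ w) hψ
  exact hloc.congr_of_eventuallyEq (Filter.eventually_of_mem (hTopen.mem_nhds hψ) fun ψ' hψ' => heq ψ' hψ')

variable
  (γH : ({w : InfinitePlace L // IsComplex w} → Fin 3 → Circle) →
    ↥(UnitaryGroup.arch (↥(maximalRealSubfield L)) L (IsCMField.complexConj L) 2
        (Matrix.of fun i j : Fin 2 => if i.val + j.val + 1 = 2 then (1 : L) else 0)) ×
      ↥(UnitaryGroup.arch (↥(maximalRealSubfield L)) L (IsCMField.complexConj L) 1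
        (Matrix.of fun i j : Fin 1 => if i.val + j.val + 1 = 1 then (1 : L) else 0)))
  (hγH : γH = fun z =>
    ((UnitaryGroup.archPiEquivCM 2 L (Matrix.of fun i j : Fin 2 => if i.val + j.val + 1 = 2 then (1 : L) else 0)).symm fun w =>
        ⟨Matrix.GeneralLinearGroup.mkOfDetNeZero !![(1 : ℂ), 1; 1, -1] UnitaryGroup.det_cayleyTwo_ne_zero *
            UnitaryGroup.circleDiagonal 2 ![z w 0, z w 2] *
          (Matrix.GeneralLinearGroup.mkOfDetNeZero !![(1 : ℂ), 1; 1, -1] UnitaryGroup.det_cayleyTwo_ne_zero)⁻¹,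
          UnitaryGroup.cayley_conj_circleDiagonal_mem_archLocal L w _⟩,
      (UnitaryGroup.archPiEquivCM 1 L (Matrix.of fun i j : Fin 1 => if i.val + j.val + 1 = 1 then (1 : L) else 0)).symm fun w =>
        ⟨UnitaryGroup.circleDiagonal 1 ![z w 1], UnitaryGroup.circleDiagonal_mem_archLocal_antidiagOne L w _⟩))
  (μ : HeckeCharacter L)

include hγH in
open scoped Classical in
/-- (M2∕M3-def) with the curve as an equality binder (proof engine; instantiate with `rfl`). [cite: Rogawski1990, §8.2 pp. 122–124; §14.2 p. 232] [cite: Shelstad1979, §4] -/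
theorem exists_tendsto_sum_archExplicitDelta_mul_integral_splitCurve_hWall_of_definite_aux
    (νw : ∀ v : {w : InfinitePlace L // IsComplex w}, Measure (archLocal L 3 (Matrix.diagonal α) v)) [∀ v, (νw v).IsHaarMeasure]
    (hα : ∀ i, α i ≠ 0) (hherm : ∀ i, (IsCMField.complexConj L (α i) : L) = α i)
    (hdef : ∀ i j, 0 < (w.1.embedding (α i)).re * (w.1.embedding (α j)).re)
    (hμω : ∀ x : ideleGroup ↥(maximalRealSubfield L), μ (AdeleRing.ideleBaseChange (↥(maximalRealSubfield L)) L x) = quadraticHeckeCharCM L x)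
    (Θ : Matrix (Fin 3) (Fin 3) (mixedSpace L) → ℂ) (hΘ : ContDiff ℝ (⊤ : ℕ∞) Θ)
    (hΘc : HasCompactSupport fun g : arch (↥(maximalRealSubfield L)) L (IsCMField.complexConj L) 3 (Matrix.diagonal α) => Θ ((g : GL (Fin 3) (mixedSpace L)) : Matrix (Fin 3) (Fin 3) (mixedSpace L)))
    (z : {w : InfinitePlace L // IsComplex w} → Fin 3 → Circle) (hz : ∀ v, v ≠ w → Function.Injective (z v)) (h02 : z w 0 = z w 2) (h01 : z w 0 ≠ z w 1)
    (c : ℝ → Fin 3 → Circle) (hc : c = fun ψ i => z w i * Circle.exp (![(1 : ℝ), 0, -1] i * ψ)) :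
    ∃ A B : ℂ,
      Tendsto (fun ψ : ℝ => ∑ ρ : {w : InfinitePlace L // IsComplex w} → Perm (Fin 3),
          archExplicitDelta L (Matrix.diagonal α) (γH fun v => Function.update z w (c ψ) v) μ (archDiagTorus L 3 α fun v => Function.update z w (c ψ) v ∘ ⇑(ρ v)) *
            ∫ g, Θ (((g * archDiagTorus L 3 α (fun v => Function.update z w (c ψ) v ∘ ⇑(ρ v)) * g⁻¹ :
              arch (↥(maximalRealSubfield L)) L (IsCMField.complexConj L) 3 (Matrix.diagonal α)) : GL (Fin 3) (mixedSpace L)) : Matrix (Fin 3) (Fin 3) (mixedSpace L))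
              ∂((Measure.pi νw).map (archPiEquivCM 3 L (Matrix.diagonal α)).symm)) (𝓝[≠] 0) (𝓝 A) ∧
      Tendsto (fun ψ : ℝ => deriv (fun ψ : ℝ => ∑ ρ : {w : InfinitePlace L // IsComplex w} → Perm (Fin 3),
          archExplicitDelta L (Matrix.diagonal α) (γH fun v => Function.update z w (c ψ) v) μ (archDiagTorus L 3 α fun v => Function.update z w (c ψ) v ∘ ⇑(ρ v)) *
            ∫ g, Θ (((g * archDiagTorus L 3 α (fun v => Function.update z w (c ψ) v ∘ ⇑(ρ v)) * g⁻¹ :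
              arch (↥(maximalRealSubfield L)) L (IsCMField.complexConj L) 3 (Matrix.diagonal α)) : GL (Fin 3) (mixedSpace L)) : Matrix (Fin 3) (Fin 3) (mixedSpace L))
              ∂((Measure.pi νw).map (archPiEquivCM 3 L (Matrix.diagonal α)).symm)) ψ) (𝓝[≠] 0) (𝓝 B) := by
  -- ABBREVIATIONS: the bare orbital function `O_ρ`, the sign product `K_ρ`
  obtain ⟨G, hG⟩ : ∃ G : ({w : InfinitePlace L // IsComplex w} → Perm (Fin 3)) → ℝ → ℂ, G = fun (ρ : {w : InfinitePlace L // IsComplex w} → Perm (Fin 3)) (ψ : ℝ) =>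
      ∫ g, Θ (((g * archDiagTorus L 3 α (fun v => Function.update z w (c ψ) v ∘ ⇑(ρ v)) * g⁻¹ :
        arch (↥(maximalRealSubfield L)) L (IsCMField.complexConj L) 3 (Matrix.diagonal α)) : GL (Fin 3) (mixedSpace L)) : Matrix (Fin 3) (Fin 3) (mixedSpace L))
        ∂((Measure.pi νw).map (archPiEquivCM 3 L (Matrix.diagonal α)).symm) := ⟨_, rfl⟩
  obtain ⟨K, hK⟩ : ∃ K : ({w : InfinitePlace L // IsComplex w} → Perm (Fin 3)) → ℤ, ∀ ρ, K ρ =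
      (∏ v : {w : InfinitePlace L // IsComplex w}, ((SignType.sign ((v.1.embedding (α ((ρ v).symm 1))).re) : ℤ) * archMajoritySign L (Matrix.diagonal α) v)) :=
    ⟨fun ρ => _, fun ρ => rfl⟩
  have hGρ : ∀ ρ : {w : InfinitePlace L // IsComplex w} → Perm (Fin 3), G ρ = fun ψ : ℝ =>
      ∫ g, Θ (((g * archDiagTorus L 3 α (fun v => Function.update z w (fun i => z w i * Circle.exp (![(1 : ℝ), 0, -1] i * ψ)) v ∘ ⇑(ρ v)) * g⁻¹ :
        arch (↥(maximalRealSubfield L)) L (IsCMField.complexConj L) 3 (Matrix.diagonal α)) : GL (Fin 3) (mixedSpace L)) : Matrix (Fin 3) (Fin 3) (mixedSpace L))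
        ∂((Measure.pi νw).map (archPiEquivCM 3 L (Matrix.diagonal α)).symm) := by
    intro ρ; subst hc hG; rfl
  have hcψ : ∀ ψ : ℝ, c ψ = fun i => z w i * Circle.exp (![(1 : ℝ), 0, -1] i * ψ) := fun ψ => by subst hc; rfl
  -- (1) PER-PARTNER LIMITS: every `w`-wall is compact at a definite place (★ brick C)
  have hlim : ∀ ρ : {w : InfinitePlace L // IsComplex w} → Perm (Fin 3), ∃ A B : ℂ,
      Tendsto (G ρ) (𝓝[≠] 0) (𝓝 A) ∧ Tendsto (fun ψ => deriv (G ρ) ψ) (𝓝[≠] 0) (𝓝 B) := by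
    intro ρ
    rw [hGρ ρ]
    exact exists_tendsto_integral_comp_conj_archDiagTorus_update_splitCurve_comp_of_pos L α w νw hα hherm Θ hΘ hΘc z hz h02 h01 ρ (hdef _ _)
  choose A B hA hB using hlim
  -- (2) THE LAURENT FORM OF `τ·D` ALONG THE CURVE: `= S(ψ)` with `S` entire (no zero at the `H`-wall: `z₀z₂ = ζ₀²` is constant)
  obtain ⟨k, hk⟩ := exists_archTau_mul_archWeylRatio_cayleyTorus_eq L γH hγH μ hμω
  obtain ⟨Cst, hCst⟩ : ∃ Cst : ℂ, Cst = (∏ v ∈ Finset.univ.erase w, -((((z v 0 : ℂ) * (z v 2 : ℂ)) ^ (k v)) * (((z v 1 : ℂ) - (z v 0 : ℂ)) * ((z v 1 : ℂ) - (z v 2 : ℂ))) / (z v 1 : ℂ))) :=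
    ⟨_, rfl⟩
  obtain ⟨S, hS⟩ : ∃ S : ℝ → ℂ, S = fun ψ : ℝ => Cst * -(((((z w 0 : ℂ) * (z w 0 : ℂ)) ^ (k w)) *
      ((((z w 1 : ℂ) - (z w 0 : ℂ) * Complex.exp (ψ * Complex.I)) * ((z w 1 : ℂ) - (z w 0 : ℂ) * Complex.exp (-(ψ * Complex.I)))))) / (z w 1 : ℂ)) := ⟨_, rfl⟩
  have hS_smooth : ContDiff ℝ (⊤ : ℕ∞) S := by
    have h1 : ContDiff ℝ (⊤ : ℕ∞) (fun ψ : ℝ => (ψ : ℂ)) := Complex.ofRealCLM.contDiff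
    have hA : ContDiff ℝ (⊤ : ℕ∞) (fun ψ : ℝ => Complex.exp (ψ * Complex.I)) := Complex.contDiff_exp.comp (h1.mul contDiff_const)
    have hB : ContDiff ℝ (⊤ : ℕ∞) (fun ψ : ℝ => Complex.exp (-(ψ * Complex.I))) := Complex.contDiff_exp.comp (h1.mul contDiff_const).neg
    rw [hS]
    simp only [div_eq_mul_inv]
    exact contDiff_const.mul ((contDiff_const.mul ((contDiff_const.sub (contDiff_const.mul hA)).mul (contDiff_const.sub (contDiff_const.mul hB)))).mul contDiff_const).neg
  have hc0 : ∀ ψ : ℝ, ((c ψ 0 : Circle) : ℂ) = (z w 0 : ℂ) * Complex.exp (ψ * Complex.I) := by intro ψ; subst hc; simp [Circle.coe_exp]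
  have hc1 : ∀ ψ : ℝ, ((c ψ 1 : Circle) : ℂ) = (z w 1 : ℂ) := by intro ψ; subst hc; simp
  have hc2 : ∀ ψ : ℝ, ((c ψ 2 : Circle) : ℂ) = (z w 0 : ℂ) * Complex.exp (-(ψ * Complex.I)) := by intro ψ; subst hc; simp [Circle.coe_exp, h02, Complex.exp_neg]
  have hT : ∀ ψ : ℝ, archTau L (γH fun v => Function.update z w (c ψ) v) μ * (archWeylRatio L (γH fun v => Function.update z w (c ψ) v) : ℂ) = S ψ := by
    intro ψ
    rw [hk, ← Finset.mul_prod_erase Finset.univ _ (Finset.mem_univ w), Function.update_self, hc0, hc1, hc2,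
      Finset.prod_congr rfl fun v hv => by rw [Function.update_of_ne (Finset.ne_of_mem_erase hv)], hS, hCst]
    have he : Complex.exp (ψ * Complex.I) * Complex.exp (-(ψ * Complex.I)) = 1 := by rw [← Complex.exp_add, add_neg_cancel, Complex.exp_zero]
    have hsq : ((z w 0 : ℂ) * Complex.exp (ψ * Complex.I)) * ((z w 0 : ℂ) * Complex.exp (-(ψ * Complex.I))) = (z w 0 : ℂ) * (z w 0 : ℂ) := by
      linear_combination ((z w 0 : ℂ) * (z w 0 : ℂ)) * he
    rw [hsq]
    ring
  -- (3) `Δ″`-TERMS AND `F = S · H`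
  have hΔ : ∀ (ρ : {w : InfinitePlace L // IsComplex w} → Perm (Fin 3)) (ψ : ℝ),
      archExplicitDelta L (Matrix.diagonal α) (γH fun v => Function.update z w (c ψ) v) μ (archDiagTorus L 3 α fun v => Function.update z w (c ψ) v ∘ ⇑(ρ v)) =
        (K ρ : ℂ) * S ψ := by
    intro ρ ψ
    rw [archExplicitDelta_cayleyTorus_relabel_eq_mul L α γH hγH μ (fun v => Function.update z w (c ψ) v) ρ, hT ψ, hK ρ]
  have hF : (fun ψ : ℝ => ∑ ρ : {w : InfinitePlace L // IsComplex w} → Perm (Fin 3),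
      archExplicitDelta L (Matrix.diagonal α) (γH fun v => Function.update z w (c ψ) v) μ (archDiagTorus L 3 α fun v => Function.update z w (c ψ) v ∘ ⇑(ρ v)) *
        ∫ g, Θ (((g * archDiagTorus L 3 α (fun v => Function.update z w (c ψ) v ∘ ⇑(ρ v)) * g⁻¹ :
          arch (↥(maximalRealSubfield L)) L (IsCMField.complexConj L) 3 (Matrix.diagonal α)) : GL (Fin 3) (mixedSpace L)) : Matrix (Fin 3) (Fin 3) (mixedSpace L))
          ∂((Measure.pi νw).map (archPiEquivCM 3 L (Matrix.diagonal α)).symm)) =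
      fun ψ => S ψ * ∑ ρ : {w : InfinitePlace L // IsComplex w} → Perm (Fin 3), (K ρ : ℂ) * G ρ ψ := by
    funext ψ
    rw [Finset.mul_sum]
    refine Finset.sum_congr rfl fun ρ _ => ?_
    rw [hΔ ρ ψ, hG]
    ring
  rw [hF]
  -- (4) LIMITS OF `H` AND `H′`
  have hTev : ∀ᶠ ψ in 𝓝[≠] (0 : ℝ), Function.Injective (c ψ) := by
    simp only [hcψ]; exact eventually_injective_splitCurve (z w) h02 h01
  have hGdiff : ∀ ρ : {w : InfinitePlace L // IsComplex w} → Perm (Fin 3), ∀ ψ : ℝ, Function.Injective (c ψ) → DifferentiableAt ℝ (G ρ) ψ := by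
    intro ρ ψ hψ
    rw [hGρ ρ]
    rw [hcψ ψ] at hψ
    exact differentiableAt_integral_comp_conj_archDiagTorus_update_splitCurve_comp L α w νw hα hherm Θ hΘ hΘc z hz ρ hψ
  have hH : Tendsto (fun ψ => ∑ ρ : {w : InfinitePlace L // IsComplex w} → Perm (Fin 3), (K ρ : ℂ) * G ρ ψ) (𝓝[≠] 0) (𝓝 (∑ ρ, (K ρ : ℂ) * A ρ)) :=
    tendsto_finsetSum _ fun ρ _ => (hA ρ).const_mul _
  have hHderiv : ∀ ψ : ℝ, Function.Injective (c ψ) →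
      HasDerivAt (fun ψ => ∑ ρ : {w : InfinitePlace L // IsComplex w} → Perm (Fin 3), (K ρ : ℂ) * G ρ ψ) (∑ ρ, (K ρ : ℂ) * deriv (G ρ) ψ) ψ :=
    fun ψ hψ => HasDerivAt.fun_sum fun ρ _ => ((hGdiff ρ ψ hψ).hasDerivAt).const_mul _
  have hH' : Tendsto (fun ψ => deriv (fun ψ => ∑ ρ : {w : InfinitePlace L // IsComplex w} → Perm (Fin 3), (K ρ : ℂ) * G ρ ψ) ψ) (𝓝[≠] 0)
      (𝓝 (∑ ρ, (K ρ : ℂ) * B ρ)) := by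
    refine (tendsto_finsetSum _ fun ρ _ => (hB ρ).const_mul (K ρ : ℂ)).congr' ?_
    filter_upwards [hTev] with ψ hψ
    exact ((hHderiv ψ hψ).deriv).symm
  -- (5) `F = S·H`, `F′ = S′H + SH′`
  have hS0 : Tendsto S (𝓝[≠] 0) (𝓝 (S 0)) := (hS_smooth.continuous.tendsto 0).mono_left nhdsWithin_le_nhds
  have hS1 : ∀ ψ, HasDerivAt S (deriv S ψ) ψ := fun ψ => ((hS_smooth.differentiable (by simp)) ψ).hasDerivAt
  have hS'0 : Tendsto (fun ψ => deriv S ψ) (𝓝[≠] 0) (𝓝 (deriv S 0)) :=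
    ((hS_smooth.continuous_deriv (by exact_mod_cast le_top)).tendsto 0).mono_left nhdsWithin_le_nhds
  refine ⟨S 0 * ∑ ρ, (K ρ : ℂ) * A ρ, deriv S 0 * (∑ ρ, (K ρ : ℂ) * A ρ) + S 0 * ∑ ρ, (K ρ : ℂ) * B ρ, hS0.mul hH, ?_⟩
  refine ((hS'0.mul hH).add (hS0.mul hH')).congr' ?_
  filter_upwards [hTev] with ψ hψ
  rw [(hHderiv ψ hψ).deriv]
  exact (((hS1 ψ).fun_mul (hHderiv ψ hψ)).deriv).symm

include hγH in
open scoped Classical in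
/-- **(M2∕M3-def) — AT A DEFINITE PLACE THE `Δ″`-SIDE IS `C¹` ACROSS THE `H`-WALL ALONG THE NORMAL CURVE.**  For `w` with `0 < re σ_w(α_i)·re σ_w(α_j)` (all `i, j`), base `z`
regular off `w` with `z_{w,0} = z_{w,2} ≠ z_{w,1}` and `μ|_{𝔸_{L⁺}^×} = ω`: there are `A B : ℂ` with
`F(ψ) = Σ_ρ Δ″(γ_H(z^ψ), t(z^ψ∘ρ))·∫_{G′_∞} Θ(↑↑(g·t(z^ψ∘ρ)·g⁻¹)) dν_∞ → A` and `F′ → B` as `ψ → 0`, `ψ ≠ 0` — NO jump at the `H`-wall of a definite place.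
[cite: Rogawski1990, §8.2 pp. 122–124; §14.2 p. 232] [cite: Shelstad1979, §4] [cite: Varadarajan1989, §2.4 Thm. 8] -/
theorem exists_tendsto_sum_archExplicitDelta_mul_integral_splitCurve_hWall_of_definite
    (νw : ∀ v : {w : InfinitePlace L // IsComplex w}, Measure (archLocal L 3 (Matrix.diagonal α) v)) [∀ v, (νw v).IsHaarMeasure]
    (hα : ∀ i, α i ≠ 0) (hherm : ∀ i, (IsCMField.complexConj L (α i) : L) = α i)
    (hdef : ∀ i j, 0 < (w.1.embedding (α i)).re * (w.1.embedding (α j)).re)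
    (hμω : ∀ x : ideleGroup ↥(maximalRealSubfield L), μ (AdeleRing.ideleBaseChange (↥(maximalRealSubfield L)) L x) = quadraticHeckeCharCM L x)
    (Θ : Matrix (Fin 3) (Fin 3) (mixedSpace L) → ℂ) (hΘ : ContDiff ℝ (⊤ : ℕ∞) Θ)
    (hΘc : HasCompactSupport fun g : arch (↥(maximalRealSubfield L)) L (IsCMField.complexConj L) 3 (Matrix.diagonal α) => Θ ((g : GL (Fin 3) (mixedSpace L)) : Matrix (Fin 3) (Fin 3) (mixedSpace L)))
    (z : {w : InfinitePlace L // IsComplex w} → Fin 3 → Circle) (hz : ∀ v, v ≠ w → Function.Injective (z v)) (h02 : z w 0 = z w 2) (h01 : z w 0 ≠ z w 1) :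
    ∃ A B : ℂ,
      Tendsto (fun ψ : ℝ => ∑ ρ : {w : InfinitePlace L // IsComplex w} → Perm (Fin 3),
          archExplicitDelta L (Matrix.diagonal α) (γH fun v => Function.update z w (fun i => z w i * Circle.exp (![(1 : ℝ), 0, -1] i * ψ)) v) μ
              (archDiagTorus L 3 α fun v => Function.update z w (fun i => z w i * Circle.exp (![(1 : ℝ), 0, -1] i * ψ)) v ∘ ⇑(ρ v)) *
            ∫ g, Θ (((g * archDiagTorus L 3 α (fun v => Function.update z w (fun i => z w i * Circle.exp (![(1 : ℝ), 0, -1] i * ψ)) v ∘ ⇑(ρ v)) * g⁻¹ :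
              arch (↥(maximalRealSubfield L)) L (IsCMField.complexConj L) 3 (Matrix.diagonal α)) : GL (Fin 3) (mixedSpace L)) : Matrix (Fin 3) (Fin 3) (mixedSpace L))
              ∂((Measure.pi νw).map (archPiEquivCM 3 L (Matrix.diagonal α)).symm)) (𝓝[≠] 0) (𝓝 A) ∧
      Tendsto (fun ψ : ℝ => deriv (fun ψ : ℝ => ∑ ρ : {w : InfinitePlace L // IsComplex w} → Perm (Fin 3),
          archExplicitDelta L (Matrix.diagonal α) (γH fun v => Function.update z w (fun i => z w i * Circle.exp (![(1 : ℝ), 0, -1] i * ψ)) v) μ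
              (archDiagTorus L 3 α fun v => Function.update z w (fun i => z w i * Circle.exp (![(1 : ℝ), 0, -1] i * ψ)) v ∘ ⇑(ρ v)) *
            ∫ g, Θ (((g * archDiagTorus L 3 α (fun v => Function.update z w (fun i => z w i * Circle.exp (![(1 : ℝ), 0, -1] i * ψ)) v ∘ ⇑(ρ v)) * g⁻¹ :
              arch (↥(maximalRealSubfield L)) L (IsCMField.complexConj L) 3 (Matrix.diagonal α)) : GL (Fin 3) (mixedSpace L)) : Matrix (Fin 3) (Fin 3) (mixedSpace L))
              ∂((Measure.pi νw).map (archPiEquivCM 3 L (Matrix.diagonal α)).symm)) ψ) (𝓝[≠] 0) (𝓝 B) :=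
  exists_tendsto_sum_archExplicitDelta_mul_integral_splitCurve_hWall_of_definite_aux L α w γH hγH μ νw hα hherm hdef hμω Θ hΘ hΘc z hz h02 h01 _ rfl

end HWall

end Literature.NumberTheory.Rogawski1990

end
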